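import Literature.AnabelianGeometry.AbsoluteAnabelian.AbsTopIII.ReconstructionCor110iaNatural
import Literature.AnabelianGeometry.AbsoluteAnabelian.GaloisCyclotomeReciprocityFundamental
import HarnessLib

/-!
# [AbsTopIII] Cor. 1.10 (i)(a), natural form with clause (1) PINNED on THE fundamental datum (statement)

Mochizuki, *Topics in Absolute Anabelian Geometry III*, Cor. 1.10 (i)(a) pp. 41–42 (kurims
`paper:url-5493eb38cbb7`): «one constructs the natural isomorphism `H²(G_k, μ_Ẑ(G_k)) ⥲ Ẑ` "group-theoretically"
from `G_k` via the algorithm described in the proof of [Mzk9], Proposition 1.2.1, (vii)»; Rmk. 1.10.1 (iii) p. 44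
(index convention for open injections).

WHY THIS FILE (abc-iut layer L4, row «COR110i-OPEN-INJ+FUND», L4-lead RULING of 12:4xZ item (5)(ii); successor
by abc-iut-L4-d3 of abc-iut-L4-d1's `AbsTopIII.Cor_1_10_i_a_natural` / `Cor_1_10_i_a_resNatural`,
`ReconstructionCor110iaNatural.lean`).  In those Props clause (1) reads «for SOME `G_k`-equivariant
`φ : μ_{ℚ/ℤ}(G_k) ≅ μ(k̄)`, `r_k` is levelwise THE invariant map read through `H²(φ)`».  The `G_k`-equivariant
`φ` form a `Ẑˣ`-TORSOR (abc-iut-w6-d022, `GaloisCyclotomeReciprocityZhatTwist.lean` /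
`GaloisCyclotomeReciprocityZhatTorsor.lean`: the axioms (T1)–(T4) of `TorsionReciprocityData` are invariant under
`θ ↦ θ^u`), so the ∃φ-clause admits `|Ẑˣ|` witness families `r` (the docstring's «this PINS `r_k`» over-claims;
the Prop stays true and contentful, INFO 12:02:18Z).  Print has no such freedom: its isomorphism is THE one of
[AbsAnab] Prop. 1.2.1 (vii), built on the reciprocity maps of local class field theory — in the tree THE
fundamental datum `TorsionReciprocityData.fundamental k` (abc-iut-w6-d022, `GaloisCyclotomeReciprocityFundamental.lean`:
`IsFundamental`, existence, uniqueness ON THE NOSE).  This statements file PINS clause (1) on it: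

* `AbsTopIII.Cor_1_10_i_a_natural_fund` — ONE family `r_k : H²(G_k, μ_Ẑ(G_k)) ≃+ Ẑ` over the MLFs `k : Type`
  with (1♭) for every `x` and every level `n ≥ 1`, the `ℤ/n`-component of `r_k x` is THE invariant map `inv_n`
  of the image of `x` in `H²(G_k, μ_n(k̄))` through `H²` of THE identification
  `galCyclotomeIsoTateModule k (fundamental k).equiv _` — NO existential over `φ`; (2) invariance under EVERY
  isomorphism of topological groups `α : G_{k₁} ≃ₜ* G_{k₂}`; (3) the index formula `r_{k′} ∘ Res = [k′ : k] · r_k`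
  along every finite extension `k′/k` (Rmk. 1.10.1 (iii)).

By (1♭) the family is UNIQUE (`ZHatLevel.ext_of_level`; proof-only companion
`ReconstructionCor110iaNaturalFundProofs.lean`: `Cor_1_10_i_a_natural_fund.eq_of_clause_one`, and the closer
`cor_1_10_i_a_natural_fund_holds` = abc-iut-L4-d1's `Cor110iaNat.residueIso`, whose datum IS `fundamental k`
definitionally); the open-injective functoriality «with respect to arbitrary injective open homomorphisms» of the
unique witness is `Cor110iaNat.residueIso_galCyclotomeResOE` (`ReconstructionCor110OpenInjectiveProofs.lean`).
Statement only (`Prop`; no data definition; not closable by choice — (1♭) determines every `r_k`, (2)(3) are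
then theorems about THE residue map).  HONEST FRAMING: refereed [AbsTopIII]/[AbsAnab]; classical local class
field theory; nothing here bears on [IUTchIII] Cor. 3.12 or takes a side; typed ≠ proved.
-/

noncomputable section

open CategoryTheory Function
open Field ValuativeRel
open ProfiniteGrp ProfiniteGrp.ProfiniteCompletion

namespace Literature.AnabelianGeometry.AbsoluteAnabelian

open _root_.TopRep _root_.ContRepresentation _root_.ContinuousCohomology
open Literature.NumberTheory.GaloisRepresentations
open Literature.NumberTheory.GaloisRepresentations.DiscreteGaloisModule
open Literature.AnabelianGeometry.EtaleTheta Literature.AnabelianGeometry.EtaleTheta.ZHatLevel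

namespace AbsTopIII

/-- **[AbsTopIII] Cor. 1.10 (i)(a) with Rmk. 1.10.1 (iii), clause (1) PINNED on THE fundamental datum.**
There is ONE family of additive isomorphisms `r_k : H²(G_k, μ_Ẑ(G_k)) ≃+ Ẑ`, indexed by the MLFs `k : Type`
(valued form), such that
(1♭) for every `x` and every level `n ≥ 1`, the `ℤ/n`-component of `r_k x` is THE invariant map `inv_n`
(`invMap k n`) of the image of `x` in `H²(G_k, μ_n(k̄))` through `H²` of THE identification
`μ_Ẑ(G_k) ≅ Ẑ(1)(k̄)` built on THE fundamental torsion reciprocity datum `TorsionReciprocityData.fundamental k`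
([AbsAnab] Prop. 1.2.1 (vi)/(vii): the reciprocity maps of local class field theory glued along the Verlagerung
— print's «via the algorithm described in the proof of [Mzk9], Proposition 1.2.1, (vii)»);
(2) for EVERY isomorphism of topological groups `α : G_{k₁} ≃ₜ* G_{k₂}`, `r_{k₂} (H²(α; μ_Ẑ(α)) x) = r_{k₁} x`;
(3) for every finite extension `k′/k`, `r_{k′} (Res x) = [k′ : k] · r_k x` (`Res = galCyclotomeRes k k′ 2`).
Universe `0`.  (1♭) alone determines `r`; see `Cor_1_10_i_a_natural_fund.eq_of_clause_one`.
[cite: MochizukiAbsTopIII2015, Cor 1.10 (i) p.42] [cite: MochizukiAbsTopIII2015, Remark 1.10.1 p.44] -/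
def Cor_1_10_i_a_natural_fund : Prop :=
  ∃ r : ∀ (k : Type) [Field k] [ValuativeRel k] [TopologicalSpace k] [IsNonarchimedeanLocalField k]
      [CharZero k], galCyclotomeH2 (absoluteGaloisGroup k) ≃+ Additive (completion (GrpCat.of (Multiplicative ℤ))),
    (∀ (k : Type) [Field k] [ValuativeRel k] [TopologicalSpace k] [IsNonarchimedeanLocalField k]
      [CharZero k] (x : galCyclotomeH2 (absoluteGaloisGroup k)) (n : ℕ+),
      Multiplicative.toAdd (level n (Additive.toMul (r k x))) =
        invMap k n (cohomologyMap ((muSystem k).projHom n) 2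
          ((cohomologyMap (galCyclotomeIsoTateModule k (TorsionReciprocityData.fundamental k).equiv
            (TorsionReciprocityData.fundamental k).equiv_smul).hom 2).hom x))) ∧
    (∀ (k₁ : Type) [Field k₁] [ValuativeRel k₁] [TopologicalSpace k₁] [IsNonarchimedeanLocalField k₁]
      [CharZero k₁]
      (k₂ : Type) [Field k₂] [ValuativeRel k₂] [TopologicalSpace k₂] [IsNonarchimedeanLocalField k₂]
      [CharZero k₂]
      (α : absoluteGaloisGroup k₁ ≃ₜ* absoluteGaloisGroup k₂) (x : galCyclotomeH2 (absoluteGaloisGroup k₁)),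
      r k₂ (galCyclotomeCohomologyMap α 2 x) = r k₁ x) ∧
    ∀ (k : Type) [Field k] [ValuativeRel k] [TopologicalSpace k] [IsNonarchimedeanLocalField k] [CharZero k]
      (k' : Type) [Field k'] [ValuativeRel k'] [TopologicalSpace k'] [IsNonarchimedeanLocalField k'] [CharZero k']
      [Algebra k k'] [FiniteDimensional k k'] (x : galCyclotomeH2 (absoluteGaloisGroup k)),
      r k' ((galCyclotomeRes k k' 2).hom x) = (Module.finrank k k') • r k x

end AbsTopIII

end Literature.AnabelianGeometry.AbsoluteAnabelian
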